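import Literature.NumberTheory.Automorphic.SmoothedCuspForms
import Literature.NumberTheory.Automorphic.BlockUnipotentDomains
import Literature.NumberTheory.Automorphic.GLnAutomorphicUnfolding
import Literature.NumberTheory.Automorphic.GLnZetaKernel
import Literature.NumberTheory.Automorphic.AutomorphicQuotientErgodic
import Literature.NumberTheory.Automorphic.GLnCuspidalSpectrumSiegelProofs
import Mathlib.Analysis.InnerProductSpace.Projection.Basic
import HarnessLib

/-!
# Cusp forms on `GL_n`, `n ≥ 2`, are orthogonal to the constants

Topic `NumberTheory/Automorphic`; namespace `Literature.NumberTheory.Automorphic`. A brick of the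
discharge of `GodementJacquet1972_gjZeta_meromorphic` (Godement–Jacquet (1972), §12: for `n ≥ 2`
and cuspidal `φ` the term `Φ(0) ∫ φ` of the unfolded zeta integral vanishes). For the cuspidal
subspace `L²_cusp = cuspidalSubspace n K μ` of `GLnCuspidalSpectrum` (closure of the continuous
square-integrable cusp forms) and an automorphic measure `μ`:

* `not_constantTermVanishes_const` — a non-zero constant is not a cusp form (its constant term
  along `P_k` over Tate's block fundamental domain is `c · ν(𝓕) ≠ 0`, `BlockUnipotentDomains`);
* `measure_univ_mul_measure_eq_mul_measure_preimage`, `measure_null_iff_measure_preimage_null` —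
  `ρ_H(H) μ(N) = c ν(π⁻¹ N)`, so **`μ N = 0 ↔ ν (π⁻¹ N) = 0`** (`π : GL_n(𝔸_K) → X`; Weil's formula
  of `GLnAutomorphicUnfolding` for `f = 1`, `F = 𝟙_N`);
* `oneL2` (**definition**: the constant `1 ∈ L²(X, μ)`), `inner_oneL2_left` (`⟪1, f⟫ = ∫ f dμ`),
  `rightRegular_oneL2` (`R(g) 1 = 1`), `rightRegularLI` (**definition**: `R(g)` as a linear
  isometry), `rightRegular_starProjection_oneL2` — the orthogonal projection of `1` to `L²_cusp` is
  `R`-fixed (unitarity and invariance of `L²_cusp`);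
* `starProjection_cuspidalSubspace_oneL2_eq_zero` — **that projection vanishes for `n ≥ 2`**: an
  `R`-fixed `L²` function is a.e. constant (ergodicity, `AutomorphicQuotientErgodic`), and a non-zero
  constant in `L²_cusp` would smooth (by a test function of mass one, `exists_isTestFunctionGL_integral_eq_one`)
  to the constant continuous cusp form `1` (`isContinuousCuspForm_smoothedForm`), which is absurd;
* `integral_eq_zero_of_mem_cuspidalSubspace` — **`∫_X f dμ = 0` for every `f ∈ L²_cusp`, `n ≥ 2`.**

Everything is proved.

## References

* R. Godement, H. Jacquet, *Zeta functions of simple algebras*, LNM 260 (1972), §12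
  [GodementJacquet1972].
* A. Borel, H. Jacquet, *Automorphic forms and automorphic representations*, Corvallis (1979),
  §4.4–4.6 [BorelJacquet1979].
-/

noncomputable section

open MeasureTheory Measure Set Filter Topology IsDedekindDomain NumberField
open Literature.MeasureTheory.Group
open scoped ENNReal NNReal ComplexConjugate MatrixGroups InnerProductSpace

namespace Literature.NumberTheory.Automorphic

-- the quotient carries the tree's Borel σ-algebra, not Mathlib's quotient σ-algebra
attribute [-instance] Quotient.instMeasurableSpace QuotientGroup.measurableSpace

/-! ### A non-zero constant is not cuspidal -/

section Constant

variable {n : ℕ} {K : Type} [Field K] [NumberField K]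

/-- **A non-zero constant function on the automorphic quotient is not a cusp form**: its constant
term along the standard maximal parabolic `P_k` (`0 < k < n`) is `c · ν(𝓕) ≠ 0` for the additive
Haar measure `blockHaar` of `𝔫_k(𝔸_K)` and Tate's block fundamental domain. [folklore] -/
theorem not_constantTermVanishes_const {c : ℂ} (hc : c ≠ 0) (k : ℕ) :
    ¬ ConstantTermVanishes n K (fun _ : (AdelicGroupData.gl n K).automorphicQuotient => c) k := by
  intro h
  have h1 := (h (blockHaar n k K) (scaledBlockFundamentalDomain n k K (1 : K))
    (isAddFundamentalDomain_scaledBlockFundamentalDomain one_ne_zero _) 1).2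
  rw [setIntegral_const] at h1
  have hne : (blockHaar n k K) (scaledBlockFundamentalDomain n k K (1 : K)) ≠ 0 :=
    measure_scaledBlockFundamentalDomain_ne_zero one_ne_zero _
  have hlt : (blockHaar n k K) (scaledBlockFundamentalDomain n k K (1 : K)) < ⊤ :=
    measure_scaledBlockFundamentalDomain_lt_top (1 : K) _
  have hreal : ((blockHaar n k K) (scaledBlockFundamentalDomain n k K (1 : K))).toReal ≠ 0 :=
    (ENNReal.toReal_pos hne hlt.ne).ne'
  rw [measureReal_def, smul_eq_zero] at h1
  rcases h1 with h1 | h1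
  · exact hreal h1
  · exact hc h1

end Constant

/-! ### Null sets of the quotient and of the group; `G`-invariant `L²` functions are constant -/

section Ergodic

variable {n : ℕ} {K : Type} [Field K] [NumberField K]

attribute [local instance] adelicBorel borelSpace_adelic locallyCompactSpace_adelic
  secondCountableTopology_gl_adelic measurableSpaceQuotient borelSpaceQuotient

variable (μ : Measure (AdelicGroupData.gl n K).automorphicQuotient)
  [(AdelicGroupData.gl n K).IsAutomorphicMeasure μ]
  (ν : Measure (AdelicGroupData.gl n K).Adelic) [ν.IsHaarMeasure]

/-- **`ρ_H(H) · μ(N) = c · ν(π⁻¹ N)`** for Borel `N ⊆ X` (Weil's formula for `f = 1`, `F = 𝟙_N`).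
[folklore] -/
theorem measure_univ_mul_measure_eq_mul_measure_preimage {N : Set (AdelicGroupData.gl n K).automorphicQuotient}
    (hNm : MeasurableSet N) :
    quotientSubgroupHaar n K Set.univ * μ N =
      automorphicUnfoldingConstant n K μ ν * ν ((AdelicGroupData.gl n K).toAutomorphicQuotient ⁻¹' N) := by
  have h := lintegral_fiberLIntegral_mul_eq_automorphic n K μ ν (f := fun _ => (1 : ℝ≥0∞)) measurable_const
    (F := N.indicator 1) (measurable_one.indicator hNm)
  have hfib : ∀ x : (AdelicGroupData.gl n K).automorphicQuotient,
      fiberLIntegral (AdelicGroupData.gl n K).quotientSubgroup (quotientSubgroupHaar n K)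
        (fun _ => (1 : ℝ≥0∞)) x = quotientSubgroupHaar n K Set.univ := by
    intro x
    obtain ⟨g, rfl⟩ := QuotientGroup.mk_surjective (s := (AdelicGroupData.gl n K).quotientSubgroup) x
    exact (fiberLIntegral_mk (AdelicGroupData.gl n K).quotientSubgroup (quotientSubgroupHaar n K)
      (fun _ => (1 : ℝ≥0∞)) g).trans (lintegral_const 1 |>.trans (one_mul _))
  have hL : ∫⁻ x, fiberLIntegral (AdelicGroupData.gl n K).quotientSubgroup (quotientSubgroupHaar n K)
        (fun _ => (1 : ℝ≥0∞)) x * N.indicator 1 x ∂μ = quotientSubgroupHaar n K Set.univ * μ N := by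
    rw [lintegral_congr fun x => congrArg (· * N.indicator 1 x) (hfib x), lintegral_const_mul _
      (measurable_one.indicator hNm), lintegral_indicator_one hNm]
  have hR : ∫⁻ g, (1 : ℝ≥0∞) * N.indicator 1 ((AdelicGroupData.gl n K).toAutomorphicQuotient g) ∂ν =
      ν ((AdelicGroupData.gl n K).toAutomorphicQuotient ⁻¹' N) := by
    have hm : MeasurableSet ((AdelicGroupData.gl n K).toAutomorphicQuotient ⁻¹' N) :=
      hNm.preimage (QuotientGroup.continuous_mk (N := (AdelicGroupData.gl n K).quotientSubgroup)).measurable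
    rw [← lintegral_indicator_one hm]
    refine lintegral_congr fun g => ?_
    rw [one_mul]
    rfl
  rw [← hL, h, hR]

/-- **`μ N = 0 ↔ ν (π⁻¹ N) = 0`** for Borel `N ⊆ X`: the quotient map is non-singular in both
directions (`ρ_H(H) ≠ 0`, `c ≠ 0`). [folklore] -/
theorem measure_null_iff_measure_preimage_null {N : Set (AdelicGroupData.gl n K).automorphicQuotient}
    (hNm : MeasurableSet N) :
    μ N = 0 ↔ ν ((AdelicGroupData.gl n K).toAutomorphicQuotient ⁻¹' N) = 0 := by
  have h := measure_univ_mul_measure_eq_mul_measure_preimage μ ν hNm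
  have hρ : quotientSubgroupHaar n K Set.univ ≠ 0 :=
    (isOpen_univ.measure_pos (quotientSubgroupHaar n K) ⟨1, trivial⟩).ne'
  have hc : (automorphicUnfoldingConstant n K μ ν : ℝ≥0∞) ≠ 0 := by
    exact_mod_cast (automorphicUnfoldingConstant_pos n K μ ν).ne'
  constructor
  · intro h0
    rw [h0, mul_zero] at h
    exact (mul_eq_zero.1 h.symm).resolve_left hc
  · intro h0
    rw [h0, mul_zero] at h
    exact (mul_eq_zero.1 h).resolve_left hρ

end Ergodic

/-! ### The projection of the constant function to `L²_cusp` vanishes -/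

section Orthogonal

variable {n : ℕ} {K : Type} [Field K] [NumberField K]

attribute [local instance] adelicBorel borelSpace_adelic locallyCompactSpace_adelic
  secondCountableTopology_gl_adelic measurableSpaceQuotient borelSpaceQuotient

variable (μ : Measure (AdelicGroupData.gl n K).automorphicQuotient)
  [(AdelicGroupData.gl n K).IsAutomorphicMeasure μ]

/-- The constant function `1` as an element of `L²(X, μ)` (`μ` is finite). [folklore] -/
def oneL2 : (AdelicGroupData.gl n K).L2 μ :=
  (memLp_const (1 : ℂ)).toLp (fun _ : (AdelicGroupData.gl n K).automorphicQuotient => (1 : ℂ))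

/-- `oneL2` is represented by the constant function `1`. [folklore] -/
theorem coeFn_oneL2 : ((oneL2 μ : (AdelicGroupData.gl n K).L2 μ) : (AdelicGroupData.gl n K).automorphicQuotient → ℂ) =ᵐ[μ]
    fun _ => (1 : ℂ) :=
  MemLp.coeFn_toLp _

/-- `⟪1, f⟫ = ∫_X f dμ`. [folklore] -/
theorem inner_oneL2_left (f : (AdelicGroupData.gl n K).L2 μ) :
    ⟪oneL2 μ, f⟫_ℂ = ∫ x, (f : (AdelicGroupData.gl n K).automorphicQuotient → ℂ) x ∂μ := by
  rw [MeasureTheory.L2.inner_def]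
  refine integral_congr_ae ?_
  filter_upwards [coeFn_oneL2 μ] with x hx
  rw [hx, RCLike.inner_apply', map_one, one_mul]

/-- **The constant function is fixed by the regular representation.** [folklore] -/
theorem rightRegular_oneL2 (g : (AdelicGroupData.gl n K).Adelic) :
    (AdelicGroupData.gl n K).rightRegular μ g (oneL2 μ) = oneL2 μ := by
  refine Lp.ext ?_
  have h1 := (AdelicGroupData.gl n K).rightRegular_apply_coeFn μ g (oneL2 μ)
  have h2 : (fun x : (AdelicGroupData.gl n K).automorphicQuotient =>
      ((oneL2 μ : (AdelicGroupData.gl n K).L2 μ) : (AdelicGroupData.gl n K).automorphicQuotient → ℂ) (g⁻¹ • x)) =ᵐ[μ]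
      fun _ => (1 : ℂ) :=
    (measurePreserving_smul g⁻¹ μ).quasiMeasurePreserving.ae_eq_comp (coeFn_oneL2 μ)
  exact h1.trans (h2.trans (coeFn_oneL2 μ).symm)

/-- `R(g)` as a linear isometry of `L²` (unitarity of the regular representation). [folklore] -/
def rightRegularLI (g : (AdelicGroupData.gl n K).Adelic) :
    (AdelicGroupData.gl n K).L2 μ →ₗᵢ[ℂ] (AdelicGroupData.gl n K).L2 μ :=
  { ((AdelicGroupData.gl n K).rightRegular μ g).toLinearMap with
    norm_map' := (AdelicGroupData.gl n K).norm_rightRegular_apply μ g }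

/-- `rightRegularLI g f = R(g) f` (definitional). [folklore] -/
theorem rightRegularLI_apply (g : (AdelicGroupData.gl n K).Adelic) (f : (AdelicGroupData.gl n K).L2 μ) :
    rightRegularLI μ g f = (AdelicGroupData.gl n K).rightRegular μ g f := rfl

/-- `R(g) (R(g⁻¹) f) = f`. [folklore] -/
theorem rightRegular_apply_rightRegular_inv (g : (AdelicGroupData.gl n K).Adelic) (f : (AdelicGroupData.gl n K).L2 μ) :
    (AdelicGroupData.gl n K).rightRegular μ g ((AdelicGroupData.gl n K).rightRegular μ g⁻¹ f) = f := by
  have h := congrArg (fun T : (AdelicGroupData.gl n K).L2 μ →L[ℂ] (AdelicGroupData.gl n K).L2 μ => T f)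
    (map_mul ((AdelicGroupData.gl n K).rightRegular μ) g g⁻¹)
  simp only [mul_inv_cancel, map_one] at h
  exact h.symm

/-- **The orthogonal projection of `1` to `L²_cusp` is fixed by the regular representation**
(`R(g)` is unitary and preserves `L²_cusp` and its orthogonal complement). [folklore] -/
theorem rightRegular_starProjection_oneL2 (g : (AdelicGroupData.gl n K).Adelic) :
    (AdelicGroupData.gl n K).rightRegular μ g ((cuspidalSubspace n K μ).toSubmodule.starProjection (oneL2 μ)) =
      (cuspidalSubspace n K μ).toSubmodule.starProjection (oneL2 μ) := by
  symm
  refine Submodule.eq_starProjection_of_mem_of_inner_eq_zero ?_ fun w hw => ?_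
  · exact (cuspidalSubspace n K μ).apply_mem_toSubmodule g
      ((cuspidalSubspace n K μ).toSubmodule.starProjection_apply_mem _)
  · have hw' : (AdelicGroupData.gl n K).rightRegular μ g⁻¹ w ∈ (cuspidalSubspace n K μ).toSubmodule :=
      (cuspidalSubspace n K μ).apply_mem_toSubmodule g⁻¹ hw
    have h0 := Submodule.starProjection_inner_eq_zero (K := (cuspidalSubspace n K μ).toSubmodule) (oneL2 μ) _ hw'
    have e1 : oneL2 μ - (AdelicGroupData.gl n K).rightRegular μ g
        ((cuspidalSubspace n K μ).toSubmodule.starProjection (oneL2 μ)) =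
        (AdelicGroupData.gl n K).rightRegular μ g
          (oneL2 μ - (cuspidalSubspace n K μ).toSubmodule.starProjection (oneL2 μ)) := by
      rw [map_sub, rightRegular_oneL2]
    have e2 : w = (AdelicGroupData.gl n K).rightRegular μ g ((AdelicGroupData.gl n K).rightRegular μ g⁻¹ w) :=
      (rightRegular_apply_rightRegular_inv μ g w).symm
    rw [e1, e2]
    change ⟪rightRegularLI μ g (oneL2 μ - (cuspidalSubspace n K μ).toSubmodule.starProjection (oneL2 μ)),
      rightRegularLI μ g ((AdelicGroupData.gl n K).rightRegular μ g⁻¹ w)⟫_ℂ = 0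
    rw [LinearIsometry.inner_map_map]
    exact h0

/-- **The orthogonal projection of the constant function to `L²_cusp(GL_n)` vanishes for `n ≥ 2`.**
It is fixed by `R` (`rightRegular_starProjection_oneL2`), hence a.e. a constant `κ` (ergodicity,
`AdelicGroupData.ae_eq_const_of_rightRegular_apply_eq`); if `κ ≠ 0` the constant `1` would lie in
`L²_cusp`, its smoothing by a test function of mass one — the constant function `1` again — would be
a continuous cusp form (`isContinuousCuspForm_smoothedForm`), contradicting
`not_constantTermVanishes_const`. [folklore] -/
theorem starProjection_cuspidalSubspace_oneL2_eq_zero (hn : 2 ≤ n) :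
    (cuspidalSubspace n K μ).toSubmodule.starProjection (oneL2 μ) = 0 := by
  set v := (cuspidalSubspace n K μ).toSubmodule.starProjection (oneL2 μ) with hv
  obtain ⟨κ, hκ⟩ := (AdelicGroupData.gl n K).ae_eq_const_of_rightRegular_apply_eq μ
    (f := v) (rightRegular_starProjection_oneL2 μ)
  -- `v = κ • 1` in `L²`
  have hv1 : v = κ • oneL2 μ := by
    refine Lp.ext (hκ.trans ?_)
    have h2 := Lp.coeFn_smul κ (oneL2 μ)
    filter_upwards [h2, coeFn_oneL2 μ] with x hx hx1
    rw [hx, Pi.smul_apply, hx1, smul_eq_mul, mul_one]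
    rfl
  by_contra hne
  have hκ0 : κ ≠ 0 := by
    intro h0; apply hne; rw [hv1, h0, zero_smul]
  -- then `1 ∈ L²_cusp`
  have hmem : oneL2 μ ∈ cuspidalSubspace n K μ := by
    have h1 : v ∈ (cuspidalSubspace n K μ).toSubmodule :=
      (cuspidalSubspace n K μ).toSubmodule.starProjection_apply_mem _
    rw [hv1] at h1
    have h2 := (cuspidalSubspace n K μ).toSubmodule.smul_mem κ⁻¹ h1
    rwa [smul_smul, inv_mul_cancel₀ hκ0, one_smul] at h2
  -- smoothing by a test function of mass one gives the constant function `1` as a continuous cusp form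
  obtain ⟨η, hη, hη0, hη1, -⟩ := exists_isTestFunctionGL_integral_eq_one (n := n) (K := K) Filter.univ_mem
  have hcusp := isContinuousCuspForm_smoothedForm (μ := μ) hη.continuous hη.hasCompactSupport hmem
  have hsm : smoothedForm η (oneL2 μ) = fun _ => (1 : ℂ) := by
    funext x
    obtain ⟨y, rfl⟩ : ∃ y, (AdelicGroupData.gl n K).toAutomorphicQuotient y = x := QuotientGroup.mk_surjective x
    -- the integrand equals `η` for a.e. `g`
    have hN : μ {z | ((oneL2 μ : (AdelicGroupData.gl n K).L2 μ) : (AdelicGroupData.gl n K).automorphicQuotient → ℂ) z ≠ 1} = 0 :=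
      ae_iff.1 (coeFn_oneL2 μ)
    have hNm : MeasurableSet {z | ((oneL2 μ : (AdelicGroupData.gl n K).L2 μ) :
        (AdelicGroupData.gl n K).automorphicQuotient → ℂ) z ≠ 1} :=
      (measurableSet_eq_fun (Lp.stronglyMeasurable _).measurable measurable_const).compl
    have hpre := (measure_null_iff_measure_preimage_null μ (adelicHaar n K) hNm).1 hN
    haveI : (adelicHaar n K).IsInvInvariant := isInvInvariant_of_isHaarMeasure_gl n K _
    haveI : (adelicHaar n K).IsMulRightInvariant :=
      GLn.isMulRightInvariant_of_isHaarMeasure_adelic_holds n K _ inferInstance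
    have hmp : MeasurePreserving (fun g : (AdelicGroupData.gl n K).Adelic => g⁻¹ * y) (adelicHaar n K) (adelicHaar n K) :=
      (measurePreserving_mul_right (adelicHaar n K) y).comp (Measure.measurePreserving_inv (adelicHaar n K))
    have hae : ∀ᵐ g ∂(adelicHaar n K), ((oneL2 μ : (AdelicGroupData.gl n K).L2 μ) :
        (AdelicGroupData.gl n K).automorphicQuotient → ℂ)
          (g⁻¹ • (AdelicGroupData.gl n K).toAutomorphicQuotient y) = 1 := by
      rw [ae_iff]
      have hm' : MeasurableSet ((AdelicGroupData.gl n K).toAutomorphicQuotient ⁻¹'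
          {z | ((oneL2 μ : (AdelicGroupData.gl n K).L2 μ) : (AdelicGroupData.gl n K).automorphicQuotient → ℂ) z ≠ 1}) :=
        hNm.preimage (QuotientGroup.continuous_mk (N := (AdelicGroupData.gl n K).quotientSubgroup)).measurable
      have h := hmp.measure_preimage hm'.nullMeasurableSet
      rw [hpre] at h
      exact h
    unfold smoothedForm orbitalSmoothing
    calc ∫ g, (η g : ℂ) • ((oneL2 μ : (AdelicGroupData.gl n K).L2 μ) : (AdelicGroupData.gl n K).automorphicQuotient → ℂ)
            (g⁻¹ • (AdelicGroupData.gl n K).toAutomorphicQuotient y) ∂(adelicHaar n K)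
        = ∫ g, ((η g : ℝ) : ℂ) ∂(adelicHaar n K) := by
          refine integral_congr_ae ?_
          filter_upwards [hae] with g hg
          rw [hg, smul_eq_mul, mul_one]
      _ = ((∫ g, η g ∂(adelicHaar n K) : ℝ) : ℂ) := integral_ofReal
      _ = 1 := by rw [hη1, Complex.ofReal_one]
  have h1 := hcusp.constantTermVanishes (k := 1) Nat.one_pos (by omega)
  rw [hsm] at h1
  exact not_constantTermVanishes_const one_ne_zero 1 h1

/-- **Cusp forms on `GL_n`, `n ≥ 2`, are orthogonal to the constants**: `∫_X f dμ = 0` for every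
`f ∈ L²_cusp(GL_n(K) A_G \ GL_n(𝔸_K))` (Godement–Jacquet (1972), §12: the term
`Φ(0) ∫ φ` of the zeta integral vanishes for cusp forms when `n ≥ 2`). [cite: GodementJacquet1972, §12] -/
theorem integral_eq_zero_of_mem_cuspidalSubspace (hn : 2 ≤ n) {f : (AdelicGroupData.gl n K).L2 μ}
    (hf : f ∈ cuspidalSubspace n K μ) :
    ∫ x, (f : (AdelicGroupData.gl n K).automorphicQuotient → ℂ) x ∂μ = 0 := by
  rw [← inner_oneL2_left μ f]
  have hf' : (cuspidalSubspace n K μ).toSubmodule.starProjection f = f :=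
    Submodule.starProjection_eq_self_iff.2 hf
  rw [← hf', ← Submodule.inner_starProjection_left_eq_right, starProjection_cuspidalSubspace_oneL2_eq_zero μ hn,
    inner_zero_left]

end Orthogonal

end Literature.NumberTheory.Automorphic
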